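import Mathlib.MeasureTheory.Integral.Prod
import Mathlib.MeasureTheory.Integral.IntegralEqImproper
import Literature.Analysis.FluidPDE.BurgersEntropySolution
import Literature.Analysis.PDE.BurgersHopfLaxWeakSolution
import HarnessLib

/-!
# Rest states are entropy solutions of the periodic Burgers equation (proofs)

Companion (everything proved) to `Literature/Analysis/FluidPDE/BurgersEntropySolution.lean`:
NON-VACUITY of `IsBurgersEntropySolution` and a check of the sign conventions of the weak form of
the Cauchy problem (Hörmander (2.4.1)′ = Dafermos (4.1.6)): for every `β > 0` and `c ∈ ℝ` the rest
state `w ≡ c` with datum `r₀ ≡ c` is an entropy solution (`isBurgersEntropySolution_const`). The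
content is the identity `restState_weakForm`:
`∫_{s>0}∫_ℝ (c ψₛ + (β/2) c² ψₓ) dx ds + ∫_ℝ c ψ(0,·) dx = 0` for `ψ ∈ C¹_c(ℝ²)`, from
`∫_ℝ ψₓ(s,·) = 0`, Fubini, and `∫₀^∞ ψₛ(·,x) ds = −ψ(0,x)`; with the slice lemmas
`hasDerivAt_slice_fst/snd` (`∂ₛψ = Dψ(1,0)`, `∂ₓψ = Dψ(0,1)`) and `hasCompactSupport_slice_fst/snd`.
A wrong sign of the initial layer would be refuted by `c ≠ 0`.

EXISTENCE (`burgersPeriodicEntropySolution_exists_holds`, discharging the residue named fact of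
the definitions file): the Lax–Hopf formula of `Literature/Analysis/PDE/BurgersHopfLax*.lean`
(Hörmander Lemma 2.4.1 / Thm 2.4.2, Dafermos (11.4.8)/(11.4.10)) applied to the periodic lift
`u₀ = β r₀ ∘ (↑)` and descended to the circle, `w(s, ↑x) = u(s,x)/β`: bounded, jointly measurable,
weak Cauchy problem with `C¹` tests (`PDE.hopfSolution_weakForm`), weakly continuous in time on
`(0,∞)` (`PDE.continuousOn_setIntegral_mul_hopfSolution`), Oleĭnik's E-condition pointwise
(`PDE.hopfSolution_sub_le`).

## References

* L. Hörmander, *Lectures on Nonlinear Hyperbolic Differential Equations* (1997), (2.4.1)′,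
  Lemma 2.4.1, Thm 2.4.2, (2.4.8). [Hormander1997]
* C. M. Dafermos, *Hyperbolic Conservation Laws in Continuum Physics*, 2nd ed. (2005), (4.1.6),
  Thm 6.2.1, (6.2.7), Thm 11.2.2, §11.4 (11.4.8), (11.4.10). [Dafermos2005]
-/

noncomputable section

open Set Function Filter MeasureTheory
open scoped Topology

namespace Literature.Analysis.FluidPDE

section RestState

variable {ψ : ℝ × ℝ → ℝ}

/-- The time slice of a `C¹` function has derivative `Dψ(s,x)(1,0)`. [folklore] -/
theorem hasDerivAt_slice_fst (hψ : ContDiff ℝ 1 ψ) (s x : ℝ) :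
    HasDerivAt (fun s' => ψ (s', x)) (fderiv ℝ ψ (s, x) (1, 0)) s := by
  have := ((hψ.differentiable one_ne_zero (s, x)).hasFDerivAt.comp s
    (hasFDerivAt_prodMk_left (𝕜 := ℝ) s x)).hasDerivAt
  simpa [Function.comp_def] using this

/-- The space slice of a `C¹` function has derivative `Dψ(s,x)(0,1)`. [folklore] -/
theorem hasDerivAt_slice_snd (hψ : ContDiff ℝ 1 ψ) (s x : ℝ) :
    HasDerivAt (fun x' => ψ (s, x')) (fderiv ℝ ψ (s, x) (0, 1)) x := by
  have := ((hψ.differentiable one_ne_zero (s, x)).hasFDerivAt.comp x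
    (hasFDerivAt_prodMk_right (𝕜 := ℝ) s x)).hasDerivAt
  simpa [Function.comp_def] using this

/-- Time slices of a compactly supported function on `ℝ × ℝ` have compact support. [folklore] -/
theorem hasCompactSupport_slice_fst {g : ℝ × ℝ → ℝ} (hg : HasCompactSupport g) (x : ℝ) :
    HasCompactSupport fun s' => g (s', x) := by
  refine HasCompactSupport.intro (hg.image continuous_fst) fun s hs => ?_
  by_contra h
  exact hs ⟨(s, x), subset_tsupport _ (Function.mem_support.mpr h), rfl⟩

/-- Space slices of a compactly supported function on `ℝ × ℝ` have compact support. [folklore] -/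
theorem hasCompactSupport_slice_snd {g : ℝ × ℝ → ℝ} (hg : HasCompactSupport g) (s : ℝ) :
    HasCompactSupport fun x' => g (s, x') := by
  refine HasCompactSupport.intro (hg.image continuous_snd) fun x hx => ?_
  by_contra h
  exact hx ⟨(s, x), subset_tsupport _ (Function.mem_support.mpr h), rfl⟩

/-- **The weak form of the Cauchy problem holds for rest states**: for `ψ ∈ C¹_c(ℝ²)`,
`∫_{s>0}∫_ℝ (c ψₛ + (β/2) c² ψₓ) + ∫_ℝ c ψ(0,·) = 0` (`∫_ℝ ψₓ = 0`, Fubini, and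
`∫₀^∞ ψₛ(·,x) = −ψ(0,x)`). [folklore] -/
theorem restState_weakForm (hψ : ContDiff ℝ 1 ψ) (hsupp : HasCompactSupport ψ) (β c : ℝ) :
    (∫ s in Set.Ioi (0 : ℝ), ∫ x : ℝ,
        (c * deriv (fun s' => ψ (s', x)) s + β / 2 * c ^ 2 * deriv (fun x' => ψ (s, x')) x))
      + ∫ x : ℝ, c * ψ (0, x) = 0 := by
  have hc1 : Continuous fun q : ℝ × ℝ => fderiv ℝ ψ q (1, 0) :=
    (hψ.continuous_fderiv one_ne_zero).clm_apply continuous_const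
  have hc2 : Continuous fun q : ℝ × ℝ => fderiv ℝ ψ q (0, 1) :=
    (hψ.continuous_fderiv one_ne_zero).clm_apply continuous_const
  have hs1 : HasCompactSupport fun q : ℝ × ℝ => fderiv ℝ ψ q (1, 0) := hsupp.fderiv_apply (𝕜 := ℝ) _
  have hs2 : HasCompactSupport fun q : ℝ × ℝ => fderiv ℝ ψ q (0, 1) := hsupp.fderiv_apply (𝕜 := ℝ) _
  have hmkR : ∀ s : ℝ, Continuous fun x : ℝ => (s, x) := fun s => continuous_const.prodMk continuous_id
  have hmkL : ∀ x : ℝ, Continuous fun s : ℝ => (s, x) := fun x => continuous_id.prodMk continuous_const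
  -- `∫_ℝ ψₓ(s,·) = 0`, so the inner integral is `c ∫_ℝ ψₛ(s,·)`
  have hinner : ∀ s : ℝ, ∫ x : ℝ, (c * deriv (fun s' => ψ (s', x)) s
      + β / 2 * c ^ 2 * deriv (fun x' => ψ (s, x')) x) = c * ∫ x : ℝ, fderiv ℝ ψ (s, x) (1, 0) := by
    intro s
    simp_rw [fun x => (hasDerivAt_slice_fst hψ s x).deriv, fun x => (hasDerivAt_slice_snd hψ s x).deriv]
    have hi1 : Integrable fun x => fderiv ℝ ψ (s, x) (1, 0) :=
      (hc1.comp (hmkR s)).integrable_of_hasCompactSupport (hasCompactSupport_slice_snd hs1 s)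
    have hi2 : Integrable fun x => fderiv ℝ ψ (s, x) (0, 1) :=
      (hc2.comp (hmkR s)).integrable_of_hasCompactSupport (hasCompactSupport_slice_snd hs2 s)
    have hzero : ∫ x, fderiv ℝ ψ (s, x) (0, 1) = 0 :=
      integral_eq_zero_of_hasDerivAt_of_integrable (hasDerivAt_slice_snd hψ s) hi2
        ((hψ.continuous.comp (hmkR s)).integrable_of_hasCompactSupport
          (hasCompactSupport_slice_snd hsupp s))
    rw [integral_add (hi1.const_mul c) (hi2.const_mul _), MeasureTheory.integral_const_mul,
      MeasureTheory.integral_const_mul, hzero, mul_zero, add_zero]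
  -- Fubini, then the fundamental theorem of calculus in time
  have hint : Integrable (Function.uncurry fun s x => fderiv ℝ ψ (s, x) (1, 0))
      ((volume.restrict (Set.Ioi (0 : ℝ))).prod volume) := by
    rw [Measure.restrict_prod_eq_prod_univ]
    exact (hc1.integrable_of_hasCompactSupport hs1).restrict
  have hftc : ∀ x : ℝ, ∫ s in Set.Ioi (0 : ℝ), fderiv ℝ ψ (s, x) (1, 0) = -ψ (0, x) := fun x => by
    rw [integral_Ioi_of_hasDerivAt_of_tendsto ((hψ.continuous.comp (hmkL x)).continuousWithinAt)
      (fun s _ => hasDerivAt_slice_fst hψ s x)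
      ((hc1.comp (hmkL x)).integrable_of_hasCompactSupport
        (hasCompactSupport_slice_fst hs1 x)).integrableOn
      ((hasCompactSupport_slice_fst hsupp x).is_zero_at_infty.mono_left atTop_le_cocompact)]
    simp
  have hout : ∫ s in Set.Ioi (0 : ℝ), ∫ x : ℝ, (c * deriv (fun s' => ψ (s', x)) s
      + β / 2 * c ^ 2 * deriv (fun x' => ψ (s, x')) x) = c * ∫ x : ℝ, -ψ (0, x) := by
    simp_rw [hinner]
    rw [MeasureTheory.integral_const_mul, integral_integral_swap hint]
    exact congrArg _ (integral_congr_ae (Filter.Eventually.of_forall hftc))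
  rw [hout, MeasureTheory.integral_neg, MeasureTheory.integral_const_mul]
  ring

/-- **Rest states are entropy solutions.** For every `β > 0` and `c ∈ ℝ`, the constant field
`w ≡ c` is an entropy solution with datum `r₀ ≡ c` (non-vacuity of `IsBurgersEntropySolution`;
the weak form pins down the sign of the initial layer). [folklore] -/
theorem isBurgersEntropySolution_const {β : ℝ} (hβ : 0 < β) (c : ℝ) :
    IsBurgersEntropySolution β (fun _ => c) (fun _ _ => c) := by
  refine ⟨⟨⟨|c|, fun _ _ => le_rfl⟩, measurable_const, fun ψ hψ hsupp => ?_⟩,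
    fun φ hφ => continuousOn_const, fun s hs ξ h hh => ?_⟩
  · exact restState_weakForm hψ hsupp β c
  · simp only [sub_self]
    positivity

end RestState

/-! ### Existence of the periodic entropy solution: the Lax–Hopf formula -/

section Existence

/-- **Existence of the periodic entropy solution (discharge of
`burgersPeriodicEntropySolution_exists`; Dafermos 2005 Thm 6.2.1 with (4.1.6), (6.2.7) and
Thm 11.2.2; Hörmander 1997 Lemma 2.4.1, Thm 2.4.2; Hopf 1950, Lax 1957).** For `β > 0` and a
bounded measurable datum `r₀` on the circle, lift the datum to the line, `u₀(x) = β r₀(↑x)`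
(bounded, measurable, `1`-periodic), take Hopf's solution `u(t,x) = (x - y₊(t,x))/t` of
`uₜ + (u²/2)ₓ = 0` given by the Lax–Hopf formula (`PDE.hopfSolution`, files
`Literature/Analysis/PDE/BurgersHopfLax*.lean`), which is `1`-periodic in `x`
(`PDE.hopfSolution_periodic`), and descend `w(s,ξ) = u(s,x)/β`, `ξ = ↑x`. Then `w` is bounded
(`|u| ≤ βM`), jointly measurable, solves the weak Cauchy problem with `C¹` tests
(`PDE.hopfSolution_weakForm`, scaled by `1/β`), is weakly continuous in time on `(0,∞)`
(`PDE.continuousOn_setIntegral_mul_hopfSolution`), and satisfies Oleĭnik's E-condition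
`w(s,ξ+h) - w(s,ξ) ≤ h/(βs)` pointwise (`PDE.hopfSolution_sub_le`, Hörmander (2.4.8)).
[cite: Dafermos2005, Thm 6.2.1 with (4.1.6), (6.2.7) and Thm 11.2.2] -/
theorem burgersPeriodicEntropySolution_exists_holds : burgersPeriodicEntropySolution_exists := by
  intro β hβ r₀ hbdd hr
  obtain ⟨M₀, hM₀⟩ := hbdd
  -- the datum lifted to the line
  set u₀ : ℝ → ℝ := fun x => β * r₀ (x : UnitAddCircle) with hu₀
  have hm : Measurable u₀ := (hr.comp AddCircle.measurable_mk').const_mul β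
  have hM : ∀ x, |u₀ x| ≤ β * M₀ := fun x => by
    simp only [hu₀, abs_mul, abs_of_pos hβ]
    exact mul_le_mul_of_nonneg_left (hM₀ _) hβ.le
  have hper : Function.Periodic u₀ 1 := fun x => by
    simp only [hu₀, AddCircle.coe_add, AddCircle.coe_period, add_zero]
  -- the section `(0, 1] → ℝ` of the covering map
  set σ : UnitAddCircle → ℝ := fun ξ => ((AddCircle.equivIoc 1 0 ξ : Ioc (0 : ℝ) (0 + 1)) : ℝ)
    with hσ
  have hσm : Measurable σ :=
    measurable_subtype_coe.comp (AddCircle.measurableEquivIoc 1 0).measurable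
  have hσcoe : ∀ ξ : UnitAddCircle, ((σ ξ : ℝ) : UnitAddCircle) = ξ := fun ξ =>
    AddCircle.coe_equivIoc
  -- Hopf's solution on the line and its descent to the circle
  set u := PDE.hopfSolution u₀ with hu
  have huper : ∀ s, Function.Periodic (u s) 1 := fun s => PDE.hopfSolution_periodic hm hM hper s
  set w : ℝ → UnitAddCircle → ℝ := fun s ξ => u s (σ ξ) / β with hw
  have hwcoe : ∀ s (x : ℝ), w s (x : UnitAddCircle) = u s x / β := by
    intro s x
    simp only [hw]
    congr 1
    have h1 := hσcoe (x : UnitAddCircle)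
    rw [QuotientAddGroup.eq] at h1
    obtain ⟨k, hk⟩ := AddSubgroup.mem_zmultiples_iff.1 h1
    have h2 : σ (x : UnitAddCircle) = x + (-k) • (1 : ℝ) := by
      rw [neg_smul, hk]
      abel
    rw [h2]
    exact (huper s).zsmul (-k) x
  have hr₀ : ∀ x : ℝ, r₀ (x : UnitAddCircle) = u₀ x / β := fun x => by
    simp only [hu₀]
    field_simp
  refine ⟨w, ⟨⟨M₀, fun s ξ => ?_⟩, ?_, fun ψ hψ hsupp => ?_⟩, fun φ hφ => ?_,
    fun s hs ξ h hh => ?_⟩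
  · -- bounded
    simp only [hw, abs_div, abs_of_pos hβ, div_le_iff₀ hβ]
    calc |u s (σ ξ)| ≤ β * M₀ := PDE.abs_hopfSolution_le hm hM _ _
      _ = M₀ * β := mul_comm _ _
  · -- jointly measurable
    change Measurable fun p : ℝ × UnitAddCircle => u p.1 (σ p.2) / β
    exact ((PDE.measurable_uncurry_hopfSolution hm hM).comp
      (measurable_fst.prodMk (hσm.comp measurable_snd))).div_const β
  · -- the weak form of the Cauchy problem, scaled by `1/β`
    have key := PDE.hopfSolution_weakForm hm hM hψ hsupp
    simp_rw [hwcoe, hr₀]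
    have h1 : ∫ s in Set.Ioi (0 : ℝ), ∫ x : ℝ, (u s x / β * deriv (fun s' => ψ (s', x)) s
        + β / 2 * (u s x / β) ^ 2 * deriv (fun x' => ψ (s, x')) x)
        = β⁻¹ * ∫ s in Set.Ioi (0 : ℝ), ∫ x : ℝ, (u s x * deriv (fun s' => ψ (s', x)) s
          + 1 / 2 * u s x ^ 2 * deriv (fun x' => ψ (s, x')) x) := by
      rw [← MeasureTheory.integral_const_mul]
      refine congrArg (integral _) (funext fun s => ?_)
      rw [← MeasureTheory.integral_const_mul]
      refine congrArg (integral _) (funext fun x => ?_)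
      field_simp
    have h2 : ∫ x : ℝ, u₀ x / β * ψ (0, x) = β⁻¹ * ∫ x : ℝ, u₀ x * ψ (0, x) := by
      rw [← MeasureTheory.integral_const_mul]
      refine congrArg (integral _) (funext fun x => ?_)
      field_simp
    rw [h1, h2, ← mul_add, key, mul_zero]
  · -- weak continuity in time
    have hφ' : Continuous fun x : ℝ => φ (x : UnitAddCircle) / β :=
      (hφ.comp (AddCircle.continuous_mk' (1 : ℝ))).div_const β
    have hint : IntegrableOn (fun x : ℝ => φ (x : UnitAddCircle) / β) (Set.Ioc 0 1) :=
      hφ'.integrableOn_Icc.mono_set Set.Ioc_subset_Icc_self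
    have hc := PDE.continuousOn_setIntegral_mul_hopfSolution hm hM hint
    refine hc.congr fun s _ => ?_
    change ∫ ξ, φ ξ * w s ξ = ∫ x in Set.Ioc (0 : ℝ) 1, φ (x : UnitAddCircle) / β * u s x
    rw [← UnitAddCircle.integral_preimage 0, zero_add]
    refine congrArg (integral _) (funext fun x => ?_)
    rw [hwcoe]
    ring
  · -- Oleinik's condition E
    obtain ⟨x, rfl⟩ := QuotientAddGroup.mk_surjective ξ
    have e : (QuotientAddGroup.mk x : UnitAddCircle) + ((h : ℝ) : UnitAddCircle)
        = ((x + h : ℝ) : UnitAddCircle) := by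
      rw [AddCircle.coe_add]
    have hE := PDE.hopfSolution_sub_le hm hM hs (le_add_of_nonneg_right hh.le : x ≤ x + h)
    rw [add_sub_cancel_left] at hE
    rw [e, hwcoe, show (QuotientAddGroup.mk x : UnitAddCircle) = ((x : ℝ) : UnitAddCircle) from rfl,
      hwcoe, div_sub_div_same, show h / (β * s) = h / s / β by field_simp]
    exact div_le_div_of_nonneg_right hE hβ.le

end Existence

end Literature.Analysis.FluidPDE
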